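import Summits.RiemannHypothesis.RiemannHypothesis.Theses.WeilComb
import Literature.NumberTheory.LFunctions.WeilExplicit
import Literature.NumberTheory.LFunctions.WeilArchimedeanMoments
import Literature.NumberTheory.LFunctions.WeilMellinBounds
import Literature.NumberTheory.LFunctions.WeilWindowSimpleEven
import Literature.NumberTheory.LFunctions.WeilMarkovQuadratic
import Literature.NumberTheory.LFunctions.WeilGroundEnergyProofs

/-!
# Stub `stub_identity` of line `helson-dirichlet-slack` for crux `WeilComb.CombSubcritical`
(item stmt-RiemannHypothesis-1025, route route-RiemannHypothesis-WeilComb)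

The exact ground-state identity of the von Mangoldt Helson form
`⟨S_M a, a⟩ = 2 Re Σ_{m ≤ M} Σ_{n ≤ M/m} Λ(n) n^{-1/2} a(nm) conj a(m)`:

`⟨S_M a, a⟩ = Σ_{m ≤ M} ‖a m‖² (log m + Σ_{n ≤ M/m} Λ(n)/n) − D(a)`,
`D(a) = Σ_{m ≤ M} Σ_{n ≤ M/m} Λ(n) ‖a(nm) − n^{-1/2} a(m)‖²`.

Proof: complete the square along every edge `m → nm` of the divisor graph in the Perron gauge
`n^{-1/2}`: for `n ≥ 1`, `Λ(n) ‖a(nm) − n^{-1/2} a(m)‖² = Λ(n) ‖a(nm)‖² + ‖a(m)‖² Λ(n)/n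
− 2 Re(Λ(n) n^{-1/2} a(nm) conj a(m))` (elementary algebra in `re`/`im`, using `(√n)² = n`);
sum over the pairs `(m, n)`; finally reindex the pairs `1 ≤ m ≤ M`, `1 ≤ n ≤ M/m` by
`k = nm ∈ [1, M]`, `n ∣ k` (a `Finset.sum_nbij'` between sigma-finsets) and use
`Σ_{n ∣ k} Λ(n) = log k` (`ArithmeticFunction.vonMangoldt_sum`) to identify
`Σ_m Σ_{n ≤ M/m} Λ(n) ‖a(nm)‖² = Σ_{k ≤ M} ‖a k‖² log k`.
-/

noncomputable section

open scoped BigOperators ComplexConjugate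
open Complex MeasureTheory Set

namespace Summit.RiemannHypothesis.RiemannHypothesis.Theorems.WeilCombSubcritical

open Literature.NumberTheory.LFunctions

/-- Completing the square along one edge `m → n m` of the divisor graph: for `n ≥ 1`,
`Λ(n) ‖a(nm) − n^{-1/2} a(m)‖²
  = Λ(n) ‖a(nm)‖² + ‖a(m)‖² Λ(n)/n − 2 Re(Λ(n) n^{-1/2} a(nm) conj a(m))`. -/
private theorem vonMangoldt_norm_sub_sq_expand (a : ℕ → ℂ) (m : ℕ) {n : ℕ} (hn : 1 ≤ n) :
    (ArithmeticFunction.vonMangoldt n : ℝ) * ‖a (n * m) - ((Real.sqrt n : ℂ))⁻¹ * a m‖ ^ 2 =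
      (ArithmeticFunction.vonMangoldt n : ℝ) * ‖a (n * m)‖ ^ 2 +
        ‖a m‖ ^ 2 * ((ArithmeticFunction.vonMangoldt n : ℝ) / n) -
        2 * (((ArithmeticFunction.vonMangoldt n : ℝ) : ℂ) / (Real.sqrt n : ℂ) * a (n * m) *
          conj (a m)).re := by
  have hn' : (0 : ℝ) < n := by exact_mod_cast hn
  obtain ⟨s, hs0, hsn⟩ : ∃ s : ℝ, 0 < s ∧ Real.sqrt n = s := ⟨_, Real.sqrt_pos.2 hn', rfl⟩
  have hn2 : (n : ℝ) = s ^ 2 := by rw [← hsn, Real.sq_sqrt hn'.le]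
  have hs : s ≠ 0 := hs0.ne'
  rw [hsn, hn2, ← Complex.ofReal_inv, ← Complex.ofReal_div]
  generalize a (n * m) = z
  generalize a m = w
  generalize (ArithmeticFunction.vonMangoldt n : ℝ) = L
  simp only [Complex.sq_norm, Complex.normSq_apply, Complex.mul_re, Complex.mul_im, Complex.sub_re,
    Complex.sub_im, Complex.ofReal_re, Complex.ofReal_im, Complex.conj_re, Complex.conj_im]
  field_simp
  ring

/-- Reindexing the edges of the divisor graph by their endpoint:
`Σ_{m ≤ M} Σ_{n ≤ M/m} Λ(n) ‖a(nm)‖² = Σ_{k ≤ M} ‖a k‖² log k`, via `k = nm`, `n ∣ k` and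
`Σ_{n ∣ k} Λ(n) = log k`. -/
private theorem sum_vonMangoldt_norm_sq_eq (M : ℕ) (a : ℕ → ℂ) :
    ∑ m ∈ Finset.Icc 1 M, ∑ n ∈ Finset.Icc 1 (M / m),
        (ArithmeticFunction.vonMangoldt n : ℝ) * ‖a (n * m)‖ ^ 2 =
      ∑ k ∈ Finset.Icc 1 M, ‖a k‖ ^ 2 * Real.log k := by
  simp_rw [← ArithmeticFunction.vonMangoldt_sum, Finset.mul_sum]
  rw [Finset.sum_sigma', Finset.sum_sigma']
  refine Finset.sum_nbij' (fun x => ⟨x.2 * x.1, x.2⟩) (fun y => ⟨y.1 / y.2, y.2⟩) ?_ ?_ ?_ ?_ ?_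
  · rintro ⟨m, n⟩ hx
    simp only [Finset.mem_sigma, Finset.mem_Icc] at hx
    obtain ⟨⟨hm1, -⟩, hn1, hnM⟩ := hx
    have hnm : 0 < n * m := Nat.mul_pos hn1 hm1
    simp only [Finset.mem_sigma, Finset.mem_Icc, Nat.mem_divisors]
    exact ⟨⟨hnm, (Nat.le_div_iff_mul_le hm1).1 hnM⟩, dvd_mul_right n m, hnm.ne'⟩
  · rintro ⟨k, n⟩ hy
    simp only [Finset.mem_sigma, Finset.mem_Icc, Nat.mem_divisors] at hy
    obtain ⟨⟨hk1, hkM⟩, hnk, -⟩ := hy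
    have hn0 : 0 < n := Nat.pos_of_dvd_of_pos hnk hk1
    have hkn : 0 < k / n := Nat.div_pos (Nat.le_of_dvd hk1 hnk) hn0
    simp only [Finset.mem_sigma, Finset.mem_Icc]
    refine ⟨⟨hkn, (Nat.div_le_self k n).trans hkM⟩, hn0, (Nat.le_div_iff_mul_le hkn).2 ?_⟩
    rw [Nat.mul_div_cancel' hnk]
    exact hkM
  · rintro ⟨m, n⟩ hx
    simp only [Finset.mem_sigma, Finset.mem_Icc] at hx
    simp only [Nat.mul_div_cancel_left m hx.2.1]
  · rintro ⟨k, n⟩ hy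
    simp only [Finset.mem_sigma, Nat.mem_divisors] at hy
    simp only [Nat.mul_div_cancel' hy.2.1]
  · rintro ⟨m, n⟩ -
    exact mul_comm _ _

/-- **Stub 1 — the lever.** Ground-state identity of the Λ-Helson form:
`⟨S_M a, a⟩ = Σ_m ‖a_m‖² (log m + Σ_{n ≤ M/m} Λ(n)/n) − D(a)`. -/
theorem stub_identity :
    ∀ (M : ℕ) (a : ℕ → ℂ),
      2 * (∑ m ∈ Finset.Icc 1 M, ∑ n ∈ Finset.Icc 1 (M / m),
          ((ArithmeticFunction.vonMangoldt n : ℝ) : ℂ) / (Real.sqrt n : ℂ) * a (n * m) *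
            conj (a m)).re =
        (∑ m ∈ Finset.Icc 1 M, ‖a m‖ ^ 2 *
            (Real.log m + ∑ n ∈ Finset.Icc 1 (M / m),
              (ArithmeticFunction.vonMangoldt n : ℝ) / n)) -
          ∑ m ∈ Finset.Icc 1 M, ∑ n ∈ Finset.Icc 1 (M / m),
            (ArithmeticFunction.vonMangoldt n : ℝ) * ‖a (n * m) - ((Real.sqrt n : ℂ))⁻¹ * a m‖ ^ 2 := by
  intro M a
  have hD : ∑ m ∈ Finset.Icc 1 M, ∑ n ∈ Finset.Icc 1 (M / m),
      (ArithmeticFunction.vonMangoldt n : ℝ) * ‖a (n * m) - ((Real.sqrt n : ℂ))⁻¹ * a m‖ ^ 2 =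
      ∑ m ∈ Finset.Icc 1 M, ‖a m‖ ^ 2 * Real.log m +
        ∑ m ∈ Finset.Icc 1 M, ‖a m‖ ^ 2 * ∑ n ∈ Finset.Icc 1 (M / m),
          (ArithmeticFunction.vonMangoldt n : ℝ) / n -
        2 * (∑ m ∈ Finset.Icc 1 M, ∑ n ∈ Finset.Icc 1 (M / m),
          ((ArithmeticFunction.vonMangoldt n : ℝ) : ℂ) / (Real.sqrt n : ℂ) * a (n * m) *
            conj (a m)).re := by
    rw [← sum_vonMangoldt_norm_sq_eq M a, Complex.re_sum, Finset.mul_sum,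
      ← Finset.sum_add_distrib, ← Finset.sum_sub_distrib]
    refine Finset.sum_congr rfl fun m _ => ?_
    rw [Complex.re_sum, Finset.mul_sum, Finset.mul_sum, ← Finset.sum_add_distrib,
      ← Finset.sum_sub_distrib]
    refine Finset.sum_congr rfl fun n hn => ?_
    exact vonMangoldt_norm_sub_sq_expand a m (Finset.mem_Icc.1 hn).1
  have hsplit : ∑ m ∈ Finset.Icc 1 M, ‖a m‖ ^ 2 *
      (Real.log m + ∑ n ∈ Finset.Icc 1 (M / m), (ArithmeticFunction.vonMangoldt n : ℝ) / n) =
      ∑ m ∈ Finset.Icc 1 M, ‖a m‖ ^ 2 * Real.log m +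
        ∑ m ∈ Finset.Icc 1 M, ‖a m‖ ^ 2 * ∑ n ∈ Finset.Icc 1 (M / m),
          (ArithmeticFunction.vonMangoldt n : ℝ) / n := by
    rw [← Finset.sum_add_distrib]
    exact Finset.sum_congr rfl fun m _ => mul_add _ _ _
  rw [hD, hsplit]
  ring

end Summit.RiemannHypothesis.RiemannHypothesis.Theorems.WeilCombSubcritical

end
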